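import Summits.BirchSwinnertonDyer.Rank1Residual.Additive.X3BranchKummerLayerLocal
import HarnessLib

/-!
# X3, the DEGENERATE rows OFF the sub-locus: the LOCAL CUBE CONDITION AT `3` over the first layer —
# for `θ³ = 3θ − 1` and `t ∈ ℤ[θ]`, `1 + 9t` has a cube root in `ℚ̄` fixed by every `σ` of the
# decomposition group at `3` that fixes `θ` (cell `bsd-eis`, seat `bsd-eis-x3` gen 7; sequel of
# `X3BranchKummerLayerLocal.lean` and of gen 6's `X3BranchKummerLocal.lean` §2–§3 (the case `t ∈ ℤ`);
# route K1 `AdditiveBranchIMC`, crux `GordTwoRankZeroOffCaseOne` — supports only)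

HONEST FRAMING (cell `bsd-eis`, `run/shared/lean/pub/bsd-eis/README.md` §4): the programme's target of
record is the full Birch–Swinnerton-Dyer formula for every `E/ℚ` of analytic rank `≤ 1`; this file is
local algebra at `3` for the U-side LOWER BOUND of the degenerate certificate road on the rows with a
prime `ℓ ≡ ±1 (mod 9)` in `Σ₀`: a `λ`-unit `a` of `ℚ_1 = ℚ(θ)`, `θ = ζ₉ + ζ₉⁻¹`, certified by
`a·d³ = 1 + 9t` in `ℤ[θ]`, must be shown to give a Kummer class unramified at `3`, i.e. `a` must be a
cube in the completion `ℚ_{1,𝔭} = ℚ₃(θ)` (`𝔭³ = (3)`). THEOREMS ONLY (no `def`, no named fact, no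
`sorry`); nothing is booked; no label, tier or count of record moves.

## What

* §1 `exists_fixedPoint_cubeEq` — for `t₀, t₁, t₂ ∈ ℤ₃` there are `s₀, s₁, s₂ ∈ ℤ₃` with
  `s + 3(s² + s³) = t` in `ℤ₃[θ] = ℤ₃ ⊕ ℤ₃θ ⊕ ℤ₃θ²` (coordinates written out; `θ³ = 3θ − 1`): the
  map `s ↦ t − 3(s² + s³)` contracts the complete space `ℤ₃³` by `‖3‖₃ = 1/3` (Banach; Mathlib's
  `ContractingWith.fixedPoint`) because `s² + s³` has `ℤ`-integral coordinates
  (`norm_coord_sub_le`). Consequently `(1 + 3s)³ = 1 + 9t` in `ℤ₃[θ]`.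
* §2 `exists_cube_eq_of_cubic` — transported along `ℤ₃ → ℚ₃ ≃ ℚ_v → \bar{ℚ_v}`
  (`Padic.adicCompletionEquiv`): for `T ∈ \bar{ℚ_v}` with `T³ = 3T − 1` there is `b`, FIXED by every
  `ℚ_v`-automorphism fixing `T`, with `b³ = 1 + 9(t₀ + t₁T + t₂T²)`.
* §3 `exists_cubeRoot_smul_eq_self_of_decomp` — for `θ ∈ ℚ̄` with `θ³ = 3θ − 1` and `t ∈ ℤ³`: some
  cube root `β'` of `1 + 9(t₀ + t₁θ + t₂θ²)` in `ℚ̄` is fixed by every `σ ∈ D_v` (`v ∣ 3`, the tree's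
  chosen decomposition group) with `σθ = θ` — root matching through the tree's embedding
  `ι : ℚ̄ → \bar{ℚ_v}` as in gen 6's `exists_root_smul_eq_self_of_decomp`. With
  `I_v ∩ ker κ ≤ D_v ∩ Gal(ℚ̄/ℚ_1)` this is the local condition at `3` of GV's `U` for the Kummer class
  of `a = (1 + 9t)/d³`.

References: [Cassels1986] Ch. 4 Lemma 3.1 (method); [SerreLocalFields1979] Ch. II §4, Ch. X §3;
[NeukirchANT1999] Ch. II (4.6), (9.6); [Washington1997] §13.1; cell file
`run/shared/lean/pub/bsd-eis/x3-MEMO-9.md` §2.4 (d).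
-/

set_option autoImplicit false

noncomputable section

open scoped Classical NumberField

namespace Summit.BirchSwinnertonDyer.Rank1Residual.Additive

namespace KummerLayerClasses

open NumberField IsDedekindDomain Field Metric
  Literature.NumberTheory.GaloisRepresentations
  Literature.NumberTheory.EllipticCurves
  Literature.NumberTheory.EllipticCurves.GreenbergSelmer

/-! ### §1 The contraction on `ℤ₃³ = ℤ₃[θ]` -/

section Contraction

/-- Ultrametric bound for a three-term sum in `ℤ₃`. [folklore] -/
theorem norm_add_add_le_of_le {a b c : ℤ_[3]} {r : ℝ} (ha : ‖a‖ ≤ r) (hb : ‖b‖ ≤ r) (hc : ‖c‖ ≤ r) :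
    ‖a + b + c‖ ≤ r :=
  (PadicInt.nonarchimedean _ _).trans (max_le ((PadicInt.nonarchimedean _ _).trans (max_le ha hb)) hc)

/-- `‖(x − y)·B‖ ≤ ‖x − y‖` in `ℤ₃` (`‖B‖ ≤ 1`). [folklore] -/
theorem norm_sub_mul_le (x y B : ℤ_[3]) : ‖(x - y) * B‖ ≤ ‖x - y‖ := by
  rw [norm_mul]
  exact mul_le_of_le_one_right (norm_nonneg _) (PadicInt.norm_le_one _)

/-- **The coordinates of `s² + s³` in `ℤ₃[θ]` (`θ³ = 3θ − 1`, basis `1, θ, θ²`) are `1`-Lipschitz for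
the sup norm**: each is a `ℤ`-polynomial, and `A(x) − A(y) = Σ_i (x_i − y_i)·B_i(x, y)` with
`‖B_i‖ ≤ 1`. The three coordinates are written out (`θ³ = 3θ − 1`, `θ⁴ = 3θ² − θ`). [folklore] -/
theorem norm_coord_sub_le (x₀ x₁ x₂ y₀ y₁ y₂ : ℤ_[3]) :
    ‖(x₂ ^ 3 - 9 * x₁ * x₂ ^ 2 - x₁ ^ 3 - 6 * x₀ * x₁ * x₂ + x₀ ^ 3 - 2 * x₁ * x₂ + x₀ ^ 2) -
        (y₂ ^ 3 - 9 * y₁ * y₂ ^ 2 - y₁ ^ 3 - 6 * y₀ * y₁ * y₂ + y₀ ^ 3 - 2 * y₁ * y₂ + y₀ ^ 2)‖ ≤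
        max (max ‖x₀ - y₀‖ ‖x₁ - y₁‖) ‖x₂ - y₂‖ ∧
    ‖(-6 * x₂ ^ 3 + 27 * x₁ * x₂ ^ 2 - 3 * x₁ ^ 2 * x₂ + 3 * x₁ ^ 3 - 3 * x₀ * x₂ ^ 2 + 18 * x₀ * x₁ * x₂ +
          3 * x₀ ^ 2 * x₁ - x₂ ^ 2 + 6 * x₁ * x₂ + 2 * x₀ * x₁) -
        (-6 * y₂ ^ 3 + 27 * y₁ * y₂ ^ 2 - 3 * y₁ ^ 2 * y₂ + 3 * y₁ ^ 3 - 3 * y₀ * y₂ ^ 2 + 18 * y₀ * y₁ * y₂ +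
          3 * y₀ ^ 2 * y₁ - y₂ ^ 2 + 6 * y₁ * y₂ + 2 * y₀ * y₁)‖ ≤
        max (max ‖x₀ - y₀‖ ‖x₁ - y₁‖) ‖x₂ - y₂‖ ∧
    ‖(9 * x₂ ^ 3 - 3 * x₁ * x₂ ^ 2 + 9 * x₁ ^ 2 * x₂ + 9 * x₀ * x₂ ^ 2 + 3 * x₀ * x₁ ^ 2 + 3 * x₀ ^ 2 * x₂ +
          3 * x₂ ^ 2 + x₁ ^ 2 + 2 * x₀ * x₂) -
        (9 * y₂ ^ 3 - 3 * y₁ * y₂ ^ 2 + 9 * y₁ ^ 2 * y₂ + 9 * y₀ * y₂ ^ 2 + 3 * y₀ * y₁ ^ 2 + 3 * y₀ ^ 2 * y₂ +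
          3 * y₂ ^ 2 + y₁ ^ 2 + 2 * y₀ * y₂)‖ ≤
        max (max ‖x₀ - y₀‖ ‖x₁ - y₁‖) ‖x₂ - y₂‖ := by
  set δ := max (max ‖x₀ - y₀‖ ‖x₁ - y₁‖) ‖x₂ - y₂‖ with hδ
  have h0 : ‖x₀ - y₀‖ ≤ δ := (le_max_left _ _).trans (le_max_left _ _)
  have h1 : ‖x₁ - y₁‖ ≤ δ := (le_max_right _ _).trans (le_max_left _ _)
  have h2 : ‖x₂ - y₂‖ ≤ δ := le_max_right _ _
  have key : ∀ B₀ B₁ B₂ : ℤ_[3],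
      ‖(x₀ - y₀) * B₀ + (x₁ - y₁) * B₁ + (x₂ - y₂) * B₂‖ ≤ δ := fun B₀ B₁ B₂ ↦
    norm_add_add_le_of_le ((norm_sub_mul_le _ _ _).trans h0) ((norm_sub_mul_le _ _ _).trans h1)
      ((norm_sub_mul_le _ _ _).trans h2)
  refine ⟨?_, ?_, ?_⟩
  · have e : (x₂ ^ 3 - 9 * x₁ * x₂ ^ 2 - x₁ ^ 3 - 6 * x₀ * x₁ * x₂ + x₀ ^ 3 - 2 * x₁ * x₂ + x₀ ^ 2) -
        (y₂ ^ 3 - 9 * y₁ * y₂ ^ 2 - y₁ ^ 3 - 6 * y₀ * y₁ * y₂ + y₀ ^ 3 - 2 * y₁ * y₂ + y₀ ^ 2) =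
        (x₀ - y₀) * (y₀ ^ 2 - 6 * x₁ * x₂ + x₀ * y₀ + x₀ ^ 2 + y₀ + x₀) +
        (x₁ - y₁) * (-y₁ ^ 2 - 6 * x₂ * y₀ - 9 * x₂ ^ 2 - x₁ * y₁ - x₁ ^ 2 - 2 * x₂) +
        (x₂ - y₂) * (y₂ ^ 2 - 9 * y₁ * y₂ - 6 * y₀ * y₁ + x₂ * y₂ - 9 * x₂ * y₁ + x₂ ^ 2 - 2 * y₁) := by
      ring
    rw [e]; exact key _ _ _
  · have e : (-6 * x₂ ^ 3 + 27 * x₁ * x₂ ^ 2 - 3 * x₁ ^ 2 * x₂ + 3 * x₁ ^ 3 - 3 * x₀ * x₂ ^ 2 +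
          18 * x₀ * x₁ * x₂ + 3 * x₀ ^ 2 * x₁ - x₂ ^ 2 + 6 * x₁ * x₂ + 2 * x₀ * x₁) -
        (-6 * y₂ ^ 3 + 27 * y₁ * y₂ ^ 2 - 3 * y₁ ^ 2 * y₂ + 3 * y₁ ^ 3 - 3 * y₀ * y₂ ^ 2 +
          18 * y₀ * y₁ * y₂ + 3 * y₀ ^ 2 * y₁ - y₂ ^ 2 + 6 * y₁ * y₂ + 2 * y₀ * y₁) =
        (x₀ - y₀) * (-3 * x₂ ^ 2 + 3 * x₁ * y₀ + 18 * x₁ * x₂ + 3 * x₀ * x₁ + 2 * x₁) +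
        (x₁ - y₁) * (3 * y₁ ^ 2 + 3 * y₀ ^ 2 - 3 * x₂ * y₁ + 18 * x₂ * y₀ + 27 * x₂ ^ 2 + 3 * x₁ * y₁ -
          3 * x₁ * x₂ + 3 * x₁ ^ 2 + 2 * y₀ + 6 * x₂) +
        (x₂ - y₂) * (-6 * y₂ ^ 2 + 27 * y₁ * y₂ - 3 * y₁ ^ 2 - 3 * y₀ * y₂ + 18 * y₀ * y₁ - 6 * x₂ * y₂ +
          27 * x₂ * y₁ - 3 * x₂ * y₀ - 6 * x₂ ^ 2 - y₂ + 6 * y₁ - x₂) := by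
      ring
    rw [e]; exact key _ _ _
  · have e : (9 * x₂ ^ 3 - 3 * x₁ * x₂ ^ 2 + 9 * x₁ ^ 2 * x₂ + 9 * x₀ * x₂ ^ 2 + 3 * x₀ * x₁ ^ 2 +
          3 * x₀ ^ 2 * x₂ + 3 * x₂ ^ 2 + x₁ ^ 2 + 2 * x₀ * x₂) -
        (9 * y₂ ^ 3 - 3 * y₁ * y₂ ^ 2 + 9 * y₁ ^ 2 * y₂ + 9 * y₀ * y₂ ^ 2 + 3 * y₀ * y₁ ^ 2 +
          3 * y₀ ^ 2 * y₂ + 3 * y₂ ^ 2 + y₁ ^ 2 + 2 * y₀ * y₂) =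
        (x₀ - y₀) * (3 * x₂ * y₀ + 9 * x₂ ^ 2 + 3 * x₁ ^ 2 + 3 * x₀ * x₂ + 2 * x₂) +
        (x₁ - y₁) * (3 * y₀ * y₁ + 9 * x₂ * y₁ - 3 * x₂ ^ 2 + 3 * x₁ * y₀ + 9 * x₁ * x₂ + y₁ + x₁) +
        (x₂ - y₂) * (9 * y₂ ^ 2 - 3 * y₁ * y₂ + 9 * y₁ ^ 2 + 9 * y₀ * y₂ + 3 * y₀ ^ 2 + 9 * x₂ * y₂ -
          3 * x₂ * y₁ + 9 * x₂ * y₀ + 9 * x₂ ^ 2 + 3 * y₂ + 2 * y₀ + 3 * x₂) := by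
      ring
    rw [e]; exact key _ _ _

/-- **`s + 3(s² + s³) = t` is solvable in `ℤ₃[θ]`** (`θ³ = 3θ − 1`; coordinates in the basis
`1, θ, θ²` written out). The map `Φ(s) = t − 3·(s² + s³)` is a contraction of the complete metric space
`ℤ₃³` with constant `‖3‖₃ = 3⁻¹` (`norm_coord_sub_le`), so it has a fixed point (Banach). This is the
Hensel step `u ∈ 1 + 9ℤ₃[θ] ⟹ u ∈ (ℤ₃[θ]ˣ)³` in coordinates. [cite: Cassels1986, Ch. 4 Lemma 3.1 (method)]
[cite: SerreLocalFields1979, Ch. II §4 Prop. 8 (method)] -/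
theorem exists_fixedPoint_cubeEq (t₀ t₁ t₂ : ℤ_[3]) : ∃ s₀ s₁ s₂ : ℤ_[3],
    s₀ + 3 * (s₂ ^ 3 - 9 * s₁ * s₂ ^ 2 - s₁ ^ 3 - 6 * s₀ * s₁ * s₂ + s₀ ^ 3 - 2 * s₁ * s₂ + s₀ ^ 2) = t₀ ∧
    s₁ + 3 * (-6 * s₂ ^ 3 + 27 * s₁ * s₂ ^ 2 - 3 * s₁ ^ 2 * s₂ + 3 * s₁ ^ 3 - 3 * s₀ * s₂ ^ 2 +
      18 * s₀ * s₁ * s₂ + 3 * s₀ ^ 2 * s₁ - s₂ ^ 2 + 6 * s₁ * s₂ + 2 * s₀ * s₁) = t₁ ∧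
    s₂ + 3 * (9 * s₂ ^ 3 - 3 * s₁ * s₂ ^ 2 + 9 * s₁ ^ 2 * s₂ + 9 * s₀ * s₂ ^ 2 + 3 * s₀ * s₁ ^ 2 +
      3 * s₀ ^ 2 * s₂ + 3 * s₂ ^ 2 + s₁ ^ 2 + 2 * s₀ * s₂) = t₂ := by
  -- the three coordinate polynomials of `s² + s³`
  let A₀ : ℤ_[3] × ℤ_[3] × ℤ_[3] → ℤ_[3] := fun x ↦
    x.2.2 ^ 3 - 9 * x.2.1 * x.2.2 ^ 2 - x.2.1 ^ 3 - 6 * x.1 * x.2.1 * x.2.2 + x.1 ^ 3 - 2 * x.2.1 * x.2.2 + x.1 ^ 2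
  let A₁ : ℤ_[3] × ℤ_[3] × ℤ_[3] → ℤ_[3] := fun x ↦
    -6 * x.2.2 ^ 3 + 27 * x.2.1 * x.2.2 ^ 2 - 3 * x.2.1 ^ 2 * x.2.2 + 3 * x.2.1 ^ 3 - 3 * x.1 * x.2.2 ^ 2 +
      18 * x.1 * x.2.1 * x.2.2 + 3 * x.1 ^ 2 * x.2.1 - x.2.2 ^ 2 + 6 * x.2.1 * x.2.2 + 2 * x.1 * x.2.1
  let A₂ : ℤ_[3] × ℤ_[3] × ℤ_[3] → ℤ_[3] := fun x ↦
    9 * x.2.2 ^ 3 - 3 * x.2.1 * x.2.2 ^ 2 + 9 * x.2.1 ^ 2 * x.2.2 + 9 * x.1 * x.2.2 ^ 2 + 3 * x.1 * x.2.1 ^ 2 +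
      3 * x.1 ^ 2 * x.2.2 + 3 * x.2.2 ^ 2 + x.2.1 ^ 2 + 2 * x.1 * x.2.2
  let Φ : ℤ_[3] × ℤ_[3] × ℤ_[3] → ℤ_[3] × ℤ_[3] × ℤ_[3] := fun x ↦
    (t₀ - 3 * A₀ x, t₁ - 3 * A₁ x, t₂ - 3 * A₂ x)
  have h3 : ‖(3 : ℤ_[3])‖ = (3 : ℝ)⁻¹ := by
    have := @PadicInt.norm_p 3 _
    exact_mod_cast this
  -- the contraction estimate
  have hcoord : ∀ (x y : ℤ_[3] × ℤ_[3] × ℤ_[3]) (A : ℤ_[3] × ℤ_[3] × ℤ_[3] → ℤ_[3]) (t : ℤ_[3]),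
      ‖A x - A y‖ ≤ dist x y → dist (t - 3 * A x) (t - 3 * A y) ≤ (3 : ℝ)⁻¹ * dist x y := by
    intro x y A t hA
    rw [dist_eq_norm, show t - 3 * A x - (t - 3 * A y) = 3 * (A y - A x) by ring, norm_mul, h3,
      norm_sub_rev]
    exact mul_le_mul_of_nonneg_left hA (by norm_num)
  have hdist : ∀ x y : ℤ_[3] × ℤ_[3] × ℤ_[3],
      dist x y = max (max ‖x.1 - y.1‖ ‖x.2.1 - y.2.1‖) ‖x.2.2 - y.2.2‖ := fun x y ↦ by
    rw [Prod.dist_eq, Prod.dist_eq, dist_eq_norm, dist_eq_norm, dist_eq_norm, max_assoc]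
  have hLip : ∀ x y, dist (Φ x) (Φ y) ≤ ((3⁻¹ : NNReal) : ℝ) * dist x y := by
    intro x y
    have hK : ((3⁻¹ : NNReal) : ℝ) = (3 : ℝ)⁻¹ := by simp
    obtain ⟨hA0, hA1, hA2⟩ := norm_coord_sub_le x.1 x.2.1 x.2.2 y.1 y.2.1 y.2.2
    rw [← hdist] at hA0 hA1 hA2
    rw [hK, Prod.dist_eq, Prod.dist_eq]
    exact max_le (hcoord x y A₀ t₀ hA0) (max_le (hcoord x y A₁ t₁ hA1) (hcoord x y A₂ t₂ hA2))
  have hΦ : ContractingWith (3⁻¹ : NNReal) Φ :=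
    ⟨by rw [NNReal.inv_lt_one_iff (by norm_num)]; norm_num, LipschitzWith.of_dist_le_mul hLip⟩
  set x := ContractingWith.fixedPoint Φ hΦ with hx
  have hfix : Φ x = x := ContractingWith.fixedPoint_isFixedPt hΦ
  refine ⟨x.1, x.2.1, x.2.2, ?_, ?_, ?_⟩
  · have e := congrArg Prod.fst hfix
    change t₀ - 3 * A₀ x = x.1 at e
    simp only [A₀] at e
    linear_combination -e
  · have e := congrArg (fun z ↦ z.2.1) hfix
    change t₁ - 3 * A₁ x = x.2.1 at e
    simp only [A₁] at e
    linear_combination -e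
  · have e := congrArg (fun z ↦ z.2.2) hfix
    change t₂ - 3 * A₂ x = x.2.2 at e
    simp only [A₂] at e
    linear_combination -e

end Contraction

/-! ### §2 Transport along a ring homomorphism `ℤ₃ → L`: `(1 + 3s)³ = 1 + 9t` modulo `T³ − 3T + 1` -/

section Transport

/-- **`1 + 9(t₀ + t₁T + t₂T²)` is a cube in any `ℤ₃`-algebra containing a root `T` of `T³ − 3T + 1`**:
with `s ∈ ℤ₃³` from `exists_fixedPoint_cubeEq` pushed along `φ : ℤ₃ → L`,
`(1 + 3(φs₀ + φs₁T + φs₂T²))³ = 1 + 9(t₀ + t₁T + t₂T²)` — the identity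
`(1 + 3s)³ = 1 + 9(s + 3s² + 3s³)` reduced modulo `T³ − 3T + 1`. [cite: SerreLocalFields1979, Ch. II §4 Prop. 8 (method)] -/
theorem exists_cube_eq_of_cubic {L : Type*} [CommRing L] (φ : ℤ_[3] →+* L) (T : L)
    (hT : T ^ 3 = 3 * T - 1) (t₀ t₁ t₂ : ℤ) :
    ∃ s₀ s₁ s₂ : ℤ_[3], (1 + 3 * (φ s₀ + φ s₁ * T + φ s₂ * T ^ 2)) ^ 3 =
      1 + 9 * ((t₀ : L) + (t₁ : L) * T + (t₂ : L) * T ^ 2) := by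
  obtain ⟨s₀, s₁, s₂, h₀, h₁, h₂⟩ := exists_fixedPoint_cubeEq (t₀ : ℤ_[3]) (t₁ : ℤ_[3]) (t₂ : ℤ_[3])
  have h₀' := congrArg φ h₀
  have h₁' := congrArg φ h₁
  have h₂' := congrArg φ h₂
  simp only [map_add, map_sub, map_mul, map_pow, map_neg, map_ofNat, map_intCast] at h₀' h₁' h₂'
  refine ⟨s₀, s₁, s₂, ?_⟩
  set u₀ := φ s₀
  set u₁ := φ s₁
  set u₂ := φ s₂
  linear_combination (27 * u₂ ^ 3 * T ^ 3 + 81 * u₁ * u₂ ^ 2 * T ^ 2 + 81 * u₂ ^ 3 * T +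
      81 * u₁ ^ 2 * u₂ * T + 81 * u₀ * u₂ ^ 2 * T + 27 * u₂ ^ 2 * T - 27 * u₂ ^ 3 + 243 * u₁ * u₂ ^ 2 +
      27 * u₁ ^ 3 + 162 * u₀ * u₁ * u₂ + 54 * u₁ * u₂) * hT +
    9 * h₀' + 9 * T * h₁' + 9 * T ^ 2 * h₂'

end Transport

/-! ### §3 Back to `ℚ̄`: a cube root fixed by the decomposition group elements fixing `θ` -/

section Decomp

/-- **The local condition at `3` over the first layer.** `θ ∈ ℚ̄` with `θ³ = 3θ − 1`, `t₀, t₁, t₂ ∈ ℤ`,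
`v` the place of `ℚ` at `3` (as `primesEquiv.symm 3`): some cube root `β'` of `1 + 9(t₀ + t₁θ + t₂θ²)`
in `ℚ̄` is fixed by every `σ` of the decomposition group `D_v` (of the tree's chosen embedding
`ι : ℚ̄ → \bar{ℚ_v}`) with `σθ = θ`: `§2` along `ℤ₃ → ℚ₃ ≃ ℚ_v → \bar{ℚ_v}` (Mathlib's
`Padic.adicCompletionEquiv`) gives `b = 1 + 3(s₀ + s₁ιθ + s₂(ιθ)²)` with `b³ = ι(1 + 9t(θ))`, fixed by
every `ℚ_v`-automorphism fixing `ιθ`; and `ι(ζ^{3−j}β) = b` for a suitable cube root of unity (gen 6's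
root matching). Hence the Kummer class of `a = (1 + 9t)/d³` (`d ∈ ℤ[θ]`) vanishes on
`I_v ∩ Gal(ℚ̄/ℚ_∞)` (which fixes `θ`). [cite: NeukirchANT1999, Ch. II (9.6)] [cite: Cassels1986, Ch. 4 Lemma 3.1] -/
theorem exists_cubeRoot_smul_eq_self_of_decomp {θ : AlgebraicClosure ℚ} (hθ : θ ^ 3 = 3 * θ - 1)
    (t₀ t₁ t₂ : ℤ) :
    ∃ β' : AlgebraicClosure ℚ,
      β' ^ 3 = 1 + 9 * ((t₀ : AlgebraicClosure ℚ) + (t₁ : AlgebraicClosure ℚ) * θ +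
        (t₂ : AlgebraicClosure ℚ) * θ ^ 2) ∧
      ∀ σ ∈ decomp ((Rat.HeightOneSpectrum.primesEquiv (R := 𝓞 ℚ)).symm ⟨3, Nat.prime_three⟩),
        σ • θ = θ → σ • β' = β' := by
  haveI : Fact (Nat.Prime 3) := ⟨Nat.prime_three⟩
  set v := (Rat.HeightOneSpectrum.primesEquiv (R := 𝓞 ℚ)).symm ⟨3, Nat.prime_three⟩ with hv
  set ι := absClosureEmbedding ℚ (v.adicCompletion ℚ) with hι
  set a : AlgebraicClosure ℚ := 1 + 9 * ((t₀ : AlgebraicClosure ℚ) + (t₁ : AlgebraicClosure ℚ) * θ +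
    (t₂ : AlgebraicClosure ℚ) * θ ^ 2) with ha
  -- `ℤ₃ → ℚ₃ ≃ ℚ_v → \bar{ℚ_v}`
  let e : ℚ_[3] ≃ₐ[ℚ] v.adicCompletion ℚ := (Padic.adicCompletionEquiv (𝓞 ℚ) ⟨3, Nat.prime_three⟩).toAlgEquiv
  let φ : ℤ_[3] →+* AlgebraicClosure (v.adicCompletion ℚ) :=
    (algebraMap (v.adicCompletion ℚ) (AlgebraicClosure (v.adicCompletion ℚ))).comp
      (e.toAlgHom.toRingHom.comp PadicInt.Coe.ringHom)
  have hφ : ∀ z : ℤ_[3],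
      φ z = algebraMap (v.adicCompletion ℚ) (AlgebraicClosure (v.adicCompletion ℚ)) (e (z : ℚ_[3])) :=
    fun z ↦ rfl
  -- the cube root in `\bar{ℚ_v}`
  have hT : ι θ ^ 3 = 3 * ι θ - 1 := by
    have := congrArg ι hθ
    simpa [map_pow, map_sub, map_mul, map_ofNat] using this
  obtain ⟨s₀, s₁, s₂, hb⟩ := exists_cube_eq_of_cubic φ (ι θ) hT t₀ t₁ t₂
  set b : AlgebraicClosure (v.adicCompletion ℚ) := 1 + 3 * (φ s₀ + φ s₁ * ι θ + φ s₂ * ι θ ^ 2) with hbdef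
  have hιa : ι a = 1 + 9 * ((t₀ : AlgebraicClosure (v.adicCompletion ℚ)) +
      (t₁ : AlgebraicClosure (v.adicCompletion ℚ)) * ι θ +
      (t₂ : AlgebraicClosure (v.adicCompletion ℚ)) * ι θ ^ 2) := by
    simp [ha, map_mul, map_pow, map_ofNat, map_intCast]
  -- `b` is fixed by the automorphisms of `\bar{ℚ_v}/ℚ_v` fixing `ι θ`
  have hbfix : ∀ τ : absoluteGaloisGroup (v.adicCompletion ℚ), τ • ι θ = ι θ → τ • b = b := by
    intro τ hτ
    rw [absoluteGaloisGroup.smul_def] at hτ ⊢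
    have hu : ∀ z : ℤ_[3], absoluteGaloisGroup.toAlgEquiv _ τ (φ z) = φ z := fun z ↦ by
      rw [hφ]; exact AlgEquiv.commutes _ _
    rw [hbdef]
    simp only [map_add, map_mul, map_pow, map_one, map_ofNat, hτ, hu]
  -- a cube root in `ℚ̄`
  obtain ⟨β, hβ⟩ := IsAlgClosed.exists_pow_nat_eq a (by norm_num : 0 < 3)
  by_cases hb0 : b = 0
  · -- degenerate case `a = 0`
    have ha0 : a = 0 := by
      have e0 : ι a = ι 0 := by
        rw [hιa, ← hb, hb0, map_zero]; ring
      exact ι.injective e0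
    refine ⟨0, ?_, fun σ _ _ ↦ smul_zero σ⟩
    rw [ha0]; ring
  · obtain ⟨ζ, hζ⟩ := HasEnoughRootsOfUnity.exists_primitiveRoot (AlgebraicClosure ℚ) 3
    have hιβ : ι β ^ 3 = b ^ 3 := by rw [← map_pow, hβ, hιa, hb]
    have hζ' : IsPrimitiveRoot (ι ζ) 3 := hζ.map_of_injective ι.injective
    obtain ⟨j, hj, hζj⟩ := hζ'.eq_pow_of_pow_eq_one (ξ := ι β / b)
      (by rw [div_pow, hιβ, div_self (pow_ne_zero _ hb0)])
    have hιβ' : ι (ζ ^ (3 - j) * β) = b := by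
      rw [map_mul, map_pow]
      have e' : ι β = ι ζ ^ j * b := by rw [hζj, div_mul_cancel₀ _ hb0]
      rw [e', ← mul_assoc, ← pow_add, Nat.sub_add_cancel hj.le, hζ'.pow_eq_one, one_mul]
    refine ⟨ζ ^ (3 - j) * β, ?_, fun σ hσ hσθ ↦ ?_⟩
    · rw [mul_pow, ← pow_mul, mul_comm (3 - j), pow_mul, hζ.pow_eq_one, one_pow, one_mul, hβ]
    · obtain ⟨τ, rfl⟩ := hσ
      have hτT : τ • ι θ = ι θ := by
        rw [← absGaloisRestrict_apply_smul]
        exact congrArg ι hσθ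
      have key : ι (absGaloisRestrict ℚ (v.adicCompletion ℚ) τ • (ζ ^ (3 - j) * β)) =
          ι (ζ ^ (3 - j) * β) := by
        rw [absGaloisRestrict_apply_smul, hιβ', hbfix τ hτT]
      exact ι.injective key

end Decomp

end KummerLayerClasses

end Summit.BirchSwinnertonDyer.Rank1Residual.Additive

end
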